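import Summits.CriticalPhenomena.PercolationContinuityZ3.Theorems.PercNearOneGluingNoHeavyLowerTailSahiGridPatternPairCert
import Summits.CriticalPhenomena.PercolationContinuityZ3.Theorems.PercNearOneGluingNoHeavyLowerTailSahiGridPatternTopCube

/-!
# `NoHeavyLowerTail` (crux stmt-CriticalPhenomena-4575), Sahi programme P1: CHART FORMS OF THE FIBRE TERMS OF THE TWO-ORTHANT
# IDENTITY FOR THE TOP CUBE `{1,2}^n` (bookkeeping for `…SahiGridPatternTwoOrthantTop`)

Support file (Sahi cell, seat `prim-sahi-p1`, generation 21; `--supports stmt-CriticalPhenomena-4575`).  Pure proofs, no definitions,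
no `sorry`, standard axioms.  For `a = 1^n` (`↑a = {1,2}^n`): a totally distinct pair `{ξ, ξ̄η}` lies inside `↑a` iff the middle point
`η` is `0` (`ind_ones_mul_third`); the weighted fibre-Kleitman form `Σ[ξ δ̸ η] c(η)·γ(ξ)(β(ξ) − β(ξ̄η)) ≥ 0` for `c ≥ 0`
(`pairKernel_fibreKleitman_weighted_nonneg`, tree: `sum_fibre_third_le`) — giving the forms `Q_D` (`c = [η ≠ 0]`) and `Q_X` (`c = [η = 0]`);
the chart points of a top-cube point lie in the top cube iff the chart is `univ` (`ind_ones_fromSet`); and the form `Q_E` is a sum over the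
charts `T ≠ ∅, univ` of the chart-pair sums of Conjecture B, hence `≥ 0` (`pairKernel_topCube_charts_nonneg`, tree: `chartPair_sum_nonneg`,
`sum_totDist_eq_sum_sets`, `thirdPt_fromSet`). [this work]
-/

namespace Summit.CriticalPhenomena.PercolationContinuityZ3.Theorems.SahiGridPattern

open Finset SahiGrid3
open scoped BigOperators

variable {n : ℕ}



/-! ### The top cube `↑1 = {1,2}^n` as first block: chart forms of `Q_X`, `Q_D`, `Q_E` -/

/-- Per-axis fact: in a Latin triple of values, the first and third are nonzero iff the second is zero. [this work] -/
theorem fin3_nonzero_pair_iff : ∀ u v : Fin 3, u ≠ v → ((1 ≤ u ∧ 1 ≤ -(u + v)) ↔ v = 0) := by decide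

/-- For the all-ones threshold: a point and the third point of a Latin triple through it are both in `↑1` iff the middle point is `0`. [this work] -/
theorem ind_ones_mul_third (a : Pd n) (ha1 : ∀ i, a i = 1) {ξ η : Pd n} (hτ : TotDist ξ η = true) :
    ind (univ.filter fun x : Pd n => ∀ i, a i ≤ x i) ξ * ind (univ.filter fun x : Pd n => ∀ i, a i ≤ x i) (thirdPt ξ η)
      = if η = 0 then 1 else 0 := by
  have key : (ξ ∈ (univ.filter fun x : Pd n => ∀ i, a i ≤ x i) ∧ thirdPt ξ η ∈ (univ.filter fun x : Pd n => ∀ i, a i ≤ x i)) ↔ η = 0 := by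
    simp only [Finset.mem_filter, Finset.mem_univ, true_and]
    constructor
    · rintro ⟨h1, h2⟩
      funext i
      exact (fin3_nonzero_pair_iff (ξ i) (η i) ((totDist_iff.1 hτ) i)).1 ⟨(ha1 i) ▸ h1 i, (ha1 i) ▸ h2 i⟩
    · intro hη
      constructor
      · intro i; rw [ha1 i]; exact ((fin3_nonzero_pair_iff (ξ i) (η i) ((totDist_iff.1 hτ) i)).2 (by rw [hη]; rfl)).1
      · intro i; rw [ha1 i]; exact ((fin3_nonzero_pair_iff (ξ i) (η i) ((totDist_iff.1 hτ) i)).2 (by rw [hη]; rfl)).2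
  unfold ind
  by_cases hη : η = 0
  · obtain ⟨h1, h2⟩ := key.2 hη
    rw [if_pos h1, if_pos h2, if_pos hη]; ring
  · rw [if_neg hη]
    by_cases h1 : ξ ∈ (univ.filter fun x : Pd n => ∀ i, a i ≤ x i)
    · have h2 : thirdPt ξ η ∉ (univ.filter fun x : Pd n => ∀ i, a i ≤ x i) := fun h2 => hη (key.1 ⟨h1, h2⟩)
      rw [if_pos h1, if_neg h2]; ring
    · rw [if_neg h1]; ring

/-- **Chart form of `Q_D` and `Q_X` for the top cube**: for up-sets `β, γ ⊆ [3]^n`, any weight `c ≥ 0` depending on the middle point,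
`0 ≤ Σ_{ξ,η}[ξ δ̸ η]·c(η)·γ(ξ)(β(ξ) − β(ξ̄η))` (fibre Kleitman around each `η`). [this work] -/
theorem pairKernel_fibreKleitman_weighted_nonneg (c : Pd n → ℤ) (hc : ∀ η, 0 ≤ c η) (β γ : Finset (Pd n))
    (hβ : IsUpperSet (β : Set (Pd n))) (hγ : IsUpperSet (γ : Set (Pd n))) :
    0 ≤ ∑ ξ : Pd n, ∑ η : Pd n, (if TotDist ξ η = true then (1:ℤ) else 0) * (c η * (ind γ ξ * (ind β ξ - ind β (thirdPt ξ η)))) := by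
  rw [Finset.sum_comm]
  refine Finset.sum_nonneg fun η _ => ?_
  have h := sum_fibre_third_le hγ hβ η
  have e : (∑ ξ : Pd n, (if TotDist ξ η = true then (1:ℤ) else 0) * (c η * (ind γ ξ * (ind β ξ - ind β (thirdPt ξ η)))))
      = c η * ((∑ ξ : Pd n, (if TotDist ξ η = true then (1:ℤ) else 0) * (ind γ ξ * ind β ξ))
          - ∑ ξ : Pd n, (if TotDist ξ η = true then (1:ℤ) else 0) * (ind γ ξ * ind β (thirdPt ξ η))) := by
    rw [← Finset.sum_sub_distrib, Finset.mul_sum]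
    refine Finset.sum_congr rfl fun ξ _ => ?_
    ring
  rw [e]
  exact mul_nonneg (hc η) (by linarith)

/-- Chart points around a top-cube point: `u^T ∈ ↑1 ⟺ T = univ`. [this work] -/
theorem ind_ones_fromSet (a : Pd n) (ha1 : ∀ i, a i = 1) {u : Pd n} (hu : ∀ i, u i ≠ 0) (T : Finset (Fin n)) :
    ind (univ.filter fun x : Pd n => ∀ i, a i ≤ x i) (fromSet u T) = if T = univ then 1 else 0 := by
  have hv : ∀ v : Fin 3, v ≠ 0 → (1 ≤ hiVal v ∧ ¬ (1 ≤ loVal v)) := by decide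
  have key : fromSet u T ∈ (univ.filter fun x : Pd n => ∀ i, a i ≤ x i) ↔ T = univ := by
    simp only [Finset.mem_filter, Finset.mem_univ, true_and]
    constructor
    · intro h
      ext i
      simp only [Finset.mem_univ, iff_true]
      by_contra hi
      have h' := h i
      rw [ha1 i] at h'
      unfold fromSet at h'
      rw [if_neg hi] at h'
      exact (hv _ (hu i)).2 h'
    · intro hT i
      rw [ha1 i]
      unfold fromSet
      rw [if_pos (by rw [hT]; exact Finset.mem_univ i)]
      exact (hv _ (hu i)).1
  unfold ind
  by_cases hT : T = univ
  · rw [if_pos hT, if_pos (key.2 hT)]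
  · rw [if_neg hT, if_neg (fun h => hT (key.1 h))]

/-- **Chart form of `Q_E` for the top cube** (via the two-chart lemma of Conjecture B): for up-sets `β, γ ⊆ [3]^n`,
`0 ≤ Σ_{ξ,η}[ξ δ̸ η]·X(ξ)(1−X(η))(1−X(ξ̄η))·(β(ξ)−β(η))(γ(ξ)−γ(ξ̄η))`, `X = ↑1`. [this work] -/
theorem pairKernel_topCube_charts_nonneg (a : Pd n) (ha1 : ∀ i, a i = 1) (β γ : Finset (Pd n))
    (hβ : IsUpperSet (β : Set (Pd n))) (hγ : IsUpperSet (γ : Set (Pd n))) :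
    0 ≤ ∑ ξ : Pd n, ∑ η : Pd n, (if TotDist ξ η = true then (1:ℤ) else 0) *
      ((ind (univ.filter fun x : Pd n => ∀ i, a i ≤ x i) ξ
          * ((1 - ind (univ.filter fun x : Pd n => ∀ i, a i ≤ x i) η) * (1 - ind (univ.filter fun x : Pd n => ∀ i, a i ≤ x i) (thirdPt ξ η))))
        * ((ind β ξ - ind β η) * (ind γ ξ - ind γ (thirdPt ξ η)))) := by
  set X : Finset (Pd n) := univ.filter fun x : Pd n => ∀ i, a i ≤ x i with hXdef
  have hXup : IsUpperSet (X : Set (Pd n)) := by rw [hXdef]; exact isUpperSet_filter_le a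
  have htop : ∀ u ∈ X, ∀ i, u i ≠ 0 := by
    intro u hu i
    rw [hXdef, Finset.mem_filter] at hu
    have h := hu.2 i
    rw [ha1 i] at h
    have : ∀ v : Fin 3, 1 ≤ v → v ≠ 0 := by decide
    exact this _ h
  -- inner sum over the cube around `ξ` as a sum over charts
  have inner : ∀ ξ : Pd n, ξ ∈ X →
      (∑ η : Pd n, (if TotDist ξ η = true then (1:ℤ) else 0) *
        ((ind X ξ * ((1 - ind X η) * (1 - ind X (thirdPt ξ η)))) * ((ind β ξ - ind β η) * (ind γ ξ - ind γ (thirdPt ξ η)))))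
      = ∑ T : Finset (Fin n), (if T = univ then (0:ℤ) else 1) * (if T = ∅ then (0:ℤ) else 1)
          * ((ind β ξ - ind β (fromSet ξ T)) * (ind γ ξ - ind γ (fromSet ξ Tᶜ))) := by
    intro ξ hξ
    have hX1 : ind X ξ = 1 := by unfold ind; rw [if_pos hξ]
    have step : (∑ η : Pd n, (if TotDist ξ η = true then (1:ℤ) else 0) *
        ((ind X ξ * ((1 - ind X η) * (1 - ind X (thirdPt ξ η)))) * ((ind β ξ - ind β η) * (ind γ ξ - ind γ (thirdPt ξ η)))))
        = ∑ η ∈ univ.filter (fun x : Pd n => TotDist x ξ = true),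
            ((1 - ind X η) * (1 - ind X (thirdPt η ξ))) * ((ind β ξ - ind β η) * (ind γ ξ - ind γ (thirdPt η ξ))) := by
      rw [Finset.sum_filter]
      refine Finset.sum_congr rfl fun η _ => ?_
      rw [totDist_symm ξ η, thirdPt_comm ξ η, hX1]
      split_ifs <;> ring
    rw [step, sum_totDist_eq_sum_sets]
    refine Finset.sum_congr rfl fun T _ => ?_
    rw [thirdPt_fromSet, ind_ones_fromSet a ha1 (htop ξ hξ) T, ind_ones_fromSet a ha1 (htop ξ hξ) Tᶜ]
    have hc : (Tᶜ = univ) ↔ (T = ∅) := Finset.compl_eq_univ_iff T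
    by_cases h1 : T = univ <;> by_cases h2 : T = ∅ <;> simp [h1, h2, hc]
  -- regroup: Σ_ξ X(ξ)·(inner ξ) = Σ_T c_T S_T
  have hS : ∀ T : Finset (Fin n), 0 ≤ (∑ u ∈ X, (ind β u - ind β (fromSet u T)) * (ind γ u - ind γ (fromSet u Tᶜ)))
      + ∑ u ∈ X, (ind β u - ind β (fromSet u Tᶜ)) * (ind γ u - ind γ (fromSet u T)) := by
    intro T
    have h := chartPair_sum_nonneg T hXup htop hβ hγ
    rw [← Finset.sum_add_distrib]
    have e : (∑ u ∈ X, ((ind β (fromSet u T) - ind β u) * (ind γ (fromSet u Tᶜ) - ind γ u)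
        + (ind β (fromSet u Tᶜ) - ind β u) * (ind γ (fromSet u T) - ind γ u)))
        = ∑ u ∈ X, ((ind β u - ind β (fromSet u T)) * (ind γ u - ind γ (fromSet u Tᶜ))
          + (ind β u - ind β (fromSet u Tᶜ)) * (ind γ u - ind γ (fromSet u T))) :=
      Finset.sum_congr rfl fun u _ => by ring
    rw [← e]; exact h
  -- the total
  have total : (∑ ξ : Pd n, ∑ η : Pd n, (if TotDist ξ η = true then (1:ℤ) else 0) *
      ((ind X ξ * ((1 - ind X η) * (1 - ind X (thirdPt ξ η)))) * ((ind β ξ - ind β η) * (ind γ ξ - ind γ (thirdPt ξ η)))))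
      = ∑ T : Finset (Fin n), (if T = univ then (0:ℤ) else 1) * (if T = ∅ then (0:ℤ) else 1)
          * ∑ u ∈ X, (ind β u - ind β (fromSet u T)) * (ind γ u - ind γ (fromSet u Tᶜ)) := by
    -- restrict the outer sum to `X` (the summand vanishes off `X`)
    have hzero : ∀ ξ : Pd n, ξ ∉ X → (∑ η : Pd n, (if TotDist ξ η = true then (1:ℤ) else 0) *
        ((ind X ξ * ((1 - ind X η) * (1 - ind X (thirdPt ξ η)))) * ((ind β ξ - ind β η) * (ind γ ξ - ind γ (thirdPt ξ η))))) = 0 := by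
      intro ξ hξ
      refine Finset.sum_eq_zero fun η _ => ?_
      have : ind X ξ = 0 := by unfold ind; rw [if_neg hξ]
      rw [this]; ring
    rw [← Finset.sum_subset (Finset.subset_univ X) (fun ξ _ hξ => hzero ξ hξ)]
    rw [Finset.sum_congr rfl fun ξ hξ => inner ξ hξ, Finset.sum_comm]
    refine Finset.sum_congr rfl fun T _ => ?_
    rw [Finset.mul_sum]
  rw [total]
  -- symmetrise over `T ↦ Tᶜ`
  have hsym : (∑ T : Finset (Fin n), (if T = univ then (0:ℤ) else 1) * (if T = ∅ then (0:ℤ) else 1)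
      * ∑ u ∈ X, (ind β u - ind β (fromSet u T)) * (ind γ u - ind γ (fromSet u Tᶜ)))
      = ∑ T : Finset (Fin n), (if T = univ then (0:ℤ) else 1) * (if T = ∅ then (0:ℤ) else 1)
        * ∑ u ∈ X, (ind β u - ind β (fromSet u Tᶜ)) * (ind γ u - ind γ (fromSet u T)) := by
    rw [← Equiv.sum_comp (Function.Involutive.toPerm (compl : Finset (Fin n) → Finset (Fin n)) compl_compl)
      (fun T => (if T = univ then (0:ℤ) else 1) * (if T = ∅ then (0:ℤ) else 1)
        * ∑ u ∈ X, (ind β u - ind β (fromSet u T)) * (ind γ u - ind γ (fromSet u Tᶜ)))]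
    refine Finset.sum_congr rfl fun T _ => ?_
    show (if Tᶜ = univ then (0:ℤ) else 1) * (if Tᶜ = ∅ then (0:ℤ) else 1)
        * ∑ u ∈ X, (ind β u - ind β (fromSet u Tᶜ)) * (ind γ u - ind γ (fromSet u Tᶜᶜ)) = _
    rw [compl_compl]
    have h1 : (Tᶜ = univ) ↔ (T = ∅) := Finset.compl_eq_univ_iff T
    have h2 : (Tᶜ = ∅) ↔ (T = univ) := Finset.compl_eq_empty_iff T
    simp only [h1, h2]
    ring
  have hsum : 0 ≤ ∑ T : Finset (Fin n), (if T = univ then (0:ℤ) else 1) * (if T = ∅ then (0:ℤ) else 1)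
      * ((∑ u ∈ X, (ind β u - ind β (fromSet u T)) * (ind γ u - ind γ (fromSet u Tᶜ)))
          + ∑ u ∈ X, (ind β u - ind β (fromSet u Tᶜ)) * (ind γ u - ind γ (fromSet u T))) :=
    Finset.sum_nonneg fun T _ => mul_nonneg (mul_nonneg (by split_ifs <;> norm_num) (by split_ifs <;> norm_num)) (hS T)
  have hsplit : (∑ T : Finset (Fin n), (if T = univ then (0:ℤ) else 1) * (if T = ∅ then (0:ℤ) else 1)
      * ((∑ u ∈ X, (ind β u - ind β (fromSet u T)) * (ind γ u - ind γ (fromSet u Tᶜ)))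
          + ∑ u ∈ X, (ind β u - ind β (fromSet u Tᶜ)) * (ind γ u - ind γ (fromSet u T))))
      = (∑ T : Finset (Fin n), (if T = univ then (0:ℤ) else 1) * (if T = ∅ then (0:ℤ) else 1)
          * ∑ u ∈ X, (ind β u - ind β (fromSet u T)) * (ind γ u - ind γ (fromSet u Tᶜ)))
        + ∑ T : Finset (Fin n), (if T = univ then (0:ℤ) else 1) * (if T = ∅ then (0:ℤ) else 1)
          * ∑ u ∈ X, (ind β u - ind β (fromSet u Tᶜ)) * (ind γ u - ind γ (fromSet u T)) := by
    rw [← Finset.sum_add_distrib]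
    refine Finset.sum_congr rfl fun T _ => ?_
    ring
  linarith [hsum, hsplit, hsym]



end Summit.CriticalPhenomena.PercolationContinuityZ3.Theorems.SahiGridPattern
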